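/-
Copyright: statement-level skeleton of a published paper (lit-balaban cell, Phase-2 proof seat p32 gen 44). No claims beyond
what the kernel checks below.
-/
import Literature.MathematicalPhysics.QuantumFieldTheory.Balaban1983to89.B3OnePIChainBlocks

/-!
# B3 — T. Bałaban, *(Higgs)₂,₃ quantum fields in a finite volume. III. Renormalization*, CMP **88** (1983) 411–445
[Balaban1983Higgs3] — p. 415 [PDF 5] (1.17) / p. 416 [PDF 6] (1.21): ISOMORPHISMS OF GRAPHS OF THE MODEL — a bijection of the
vertices keeping the catalogue kinds whose induced bijection of the legs carries the internal lines to the internal lines — and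
the transport of everything the chain decomposition of (1.21) is made of (adjacency, cuts, paths, connectedness, properness,
one-particle-irreducibility, separating lines, near legs, levels, the number of external legs) along them

statement-level skeleton of published theorems with citation tags; proofs where landed; nothing here is a claim about
the Yang–Mills mass gap

PDF held: `paper:balaban1983-higgs-2-3-quantum-fields-finite-volume` (journal page = PDF page + 410); p. 415 L28–31 and p. 416
L13–18 of the OCR text layer re-read this session (`lit read … --pages 5-6`).

CITATION HEADER (lean-in-tree rule).  lit-balaban TYPED SKELETON (HOME `run/shared/lean/pub/lit-balaban/`), PHASE 2, seat p32
gen 44 (unit `lit-balaban-p32`; TAKING line HOME/STATUS.md 2026-08-23T13:19:54Z, free-target protocol G.5-34(d)), row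
**B3.Eq1.19-1.22** of `HOME/lit-balaban-r15/ROWS-B3.md` (fold owner r15, referee ref-4; head `proved` under the lead g12 HEAD WORD
Q25, reading (P); this file is an OPTIONAL located member of its (1.21) cell, zero head weight).  FILE 1 of 2 of the item
«glue ∘ decompose ≅ identity» (p32 gen 43 HANDOFF (d)(γ); the element «no sub-object isomorphism» that r15's gen-42/43 fold of
the (1.21) cell carries verbatim): the notion of isomorphism the converse of p37's synthesis needs, and the invariance under it
of every ingredient of p32's analysis.  FILE 2 `B3OnePIChainUnglue` builds the pieces of a two-leg graph as graphs and the
isomorphism onto p37's `chain` of them.  CONSUMES BY NAME: p18's model `B3Cor23Concrete.Graph` / `Leg` (p. 415), p37's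
`B3GraphGlueLegs.fibreCast` (p362350), `B3OnePIGraphs.Adj` / `AdjOff` / `IsConnected` / `IsConnectedOff` / `IsOnePI` /
`IsProper` (p358806), `B3OnePIChainGlue.TwoLegGraph` (p363250); p32's `B3OnePIChainDecomposition.Sep` / `IsNear` / `nearLegs` /
`numSep` / `beyond` / `level` (p361829).  Nothing re-declared (the only earlier relabelling statement of the tree,
`B3ClassOrders420.orders_eq_of_relabel`, transports the coupling orders along a kind-preserving `Fin G.nV ≃ Fin G'.nV` without
a condition on the lines; it is not an isomorphism notion and is untouched).

THE PRINTED TEXT (verbatim).  p. 415: *"Now a graph for us is a collection of internal lines, external legs, and vertices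
connected in the usual sense. There is at least one internal line, and every internal line has a vertex at each endpoint. The
construction of graphs is otherwise arbitrary."*  p. 416: *"G^ε = Σ_{n=0}^∞ C₀^ε[(−δm² + Σ^ε + ∂^{ε*}Σ₁^ε + Σ₁^{ε*}∂^ε +
∂^{ε*}Σ₂^ε∂^ε)C₀^ε]ⁿ, (1.21) where C₀^ε = (−Δ₀^ε + m²)^{−1} and Σ^ε, Σ₁^ε, Σ₂^ε are given by amputated, one-particle-irreducible
graphs of the expansion of G^ε."*  Print identifies graphs "in the usual sense", i.e. up to isomorphism; p18's carrier indexes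
vertices by `Fin nV` and legs by slots, so the identification has to be said: this file says it.

KIND «(ours)» (G.5-54): the isomorphism notion and the transport lemmas are OUR plumbing on p18's model — print provenance is
claimed only for the sentences quoted above; each declaration's cite tag locates the printed notion it serves.
WHAT IS TYPED / PROVED (definitions with bodies + theorems; no `Prop` fact, no `sorry`; standard axioms).
* `§1` `leg_ext` (two legs are equal iff same vertex and same slot after transport), `legOf σ hσ` — the leg map induced by a
  kind-preserving vertex map (`fst_legOf`, `isLeft_legOf`, `legOf_id`, `legOf_legOf`, `legOf_congr`, `legOf_symm_legOf`,
  `legOf_legOf_symm`, `legOf_injective`).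
* `§2` **`GraphIso G H`**: `toEquiv : Fin G.nV ≃ Fin H.nV`, `kind_eq`, `map_other : H.other (legOf x) = (G.other x).map legOf`;
  `legMap` / `legInv` / **`legEquiv : Leg G.kind ≃ Leg H.kind`**, `other_legMap`, `other_legMap_eq_none_iff` (external ↦ external),
  `other_legMap_eq_some_iff` (line ↦ line), **`refl`**, **`symm`**, **`trans`** (with `toEquiv_*`, `legMap_*`).
* `§3` TRANSPORT: `adj_iff'`, `adjOff_iff'`, `reflTransGen_adj_iff`, `reflTransGen_adjOff_iff`, **`isConnected_iff`**,
  `isConnectedOff_iff`, **`isOnePI_iff`**, **`isProper_iff`**, **`sep_iff`**, **`isNear_iff`**, `nearLegs_eq`, **`numSep_eq`**,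
  `beyond_eq`, **`level_eq`** (an isomorphism carries the pieces `V_k` of the chain decomposition onto the pieces),
  **`numExtLegs_eq`**.
* `§4` **`TwoLegGraphIso T T'`** (extends `GraphIso T.G T'.G`; in-leg ↦ in-leg, out-leg ↦ out-leg): `refl` / `symm` / `trans`,
  `toEquiv_legIn_fst` / `toEquiv_legOut_fst`, **`numSep_eq`** (same number of pieces), **`level_eq`**, `isConnected_iff`,
  `isProper_iff`, `isOnePI_iff`, `numExtLegs_eq`.
HONEST SCOPE.  An isomorphism keeps leg SLOTS (the canonical transport `fibreCast` along the equality of kinds): permuting the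
symmetric legs of one vertex (e.g. the four φ′-legs of (1.6)) is NOT an isomorphism here — the rigid notion p37's `glue` /
`chain` and p32's `blockEmb` / `legEmb` produce; no quotient by isomorphism (isomorphism classes, symmetry factors) is formed;
no amplitude is attached (invariance of p26's evaluator under isomorphism is not stated); nothing analytic.
-/

namespace Literature.MathematicalPhysics.QuantumFieldTheory.Balaban1983to89.B3GraphIso

open Relation Finset B3Prop1 B3Cor23Concrete B3OnePIGraphs B3OnePIChainDecomposition B3OnePIChainPieces B3GraphGlueLegs
  B3OnePIChainGlue

variable {nbar : ℕ}

/-! ## §1 Legs along a kind-preserving vertex map -/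

section LegOf

variable {n n' n'' : ℕ} {kG : Fin n → VertexKind} {kH : Fin n' → VertexKind} {kK : Fin n'' → VertexKind}

/-- kernel («(ours)», plumbing): two legs of a vertex family are equal iff they sit at the same vertex and in the same slot
(the slot compared after transport along the equality of kinds). [cite: Balaban1983Higgs3, (1.17) p.415] -/
theorem leg_ext {x y : Leg kG} (h₁ : x.1 = y.1) (h₂ : fibreCast (congrArg kG h₁) x.2 = y.2) : x = y := by
  obtain ⟨v, s⟩ := x
  obtain ⟨w, t⟩ := y
  dsimp only at h₁
  subst h₁
  simp only [fibreCast_self] at h₂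
  subst h₂
  rfl

/-- The leg map induced by a vertex map `σ` keeping the catalogue kinds («(ours)»): the leg in slot `s` of the vertex `v`
goes to the leg in slot `s` of the vertex `σ v` (same species φ′/A′, same position — the differentiated leg of (1.8) stays the
differentiated leg). [cite: Balaban1983Higgs3, (1.17) p.415] -/
def legOf (σ : Fin n → Fin n') (hσ : ∀ v, kH (σ v) = kG v) (x : Leg kG) : Leg kH :=
  ⟨σ x.1, fibreCast (hσ x.1).symm x.2⟩

/-- kernel: the vertex of the transported leg. [cite: Balaban1983Higgs3, (1.17) p.415] -/
@[simp] theorem fst_legOf (σ : Fin n → Fin n') (hσ : ∀ v, kH (σ v) = kG v) (x : Leg kG) : (legOf σ hσ x).1 = σ x.1 := rfl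

/-- kernel: the species of the transported leg. [cite: Balaban1983Higgs3, (1.17) p.415] -/
@[simp] theorem isLeft_legOf (σ : Fin n → Fin n') (hσ : ∀ v, kH (σ v) = kG v) (x : Leg kG) :
    (legOf σ hσ x).2.isLeft = x.2.isLeft := by
  simp [legOf]

/-- kernel: along the identity the leg map is the identity. [cite: Balaban1983Higgs3, (1.17) p.415] -/
@[simp] theorem legOf_id (h : ∀ v, kG (id v) = kG v) (x : Leg kG) : legOf id h x = x :=
  leg_ext rfl (by simp [legOf])

/-- kernel: leg maps compose as the vertex maps do. [cite: Balaban1983Higgs3, (1.17) p.415] -/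
theorem legOf_legOf (σ : Fin n → Fin n') (hσ : ∀ v, kH (σ v) = kG v) (τ : Fin n' → Fin n'') (hτ : ∀ w, kK (τ w) = kH w)
    (x : Leg kG) : legOf τ hτ (legOf σ hσ x) = legOf (τ ∘ σ) (fun v => (hτ (σ v)).trans (hσ v)) x :=
  leg_ext rfl (by simp [legOf])

/-- kernel: the leg map depends only on the vertex map (proof-irrelevance form, for rewriting the vertex map).
[cite: Balaban1983Higgs3, (1.17) p.415] -/
theorem legOf_congr {σ σ' : Fin n → Fin n'} (hσ : ∀ v, kH (σ v) = kG v) (hσ' : ∀ v, kH (σ' v) = kG v) (h : ∀ v, σ v = σ' v)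
    (x : Leg kG) : legOf σ hσ x = legOf σ' hσ' x :=
  leg_ext (h x.1) (by simp [legOf])

/-- kernel: along a bijection `σ`, the leg map of `σ⁻¹` undoes the leg map of `σ`. [cite: Balaban1983Higgs3, (1.17) p.415] -/
theorem legOf_symm_legOf (σ : Fin n ≃ Fin n') (hσ : ∀ v, kH (σ v) = kG v) (hσ' : ∀ w, kG (σ.symm w) = kH w) (x : Leg kG) :
    legOf σ.symm hσ' (legOf σ hσ x) = x :=
  leg_ext (σ.symm_apply_apply x.1) (by simp [legOf])

/-- kernel: … and the leg map of `σ` undoes that of `σ⁻¹`. [cite: Balaban1983Higgs3, (1.17) p.415] -/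
theorem legOf_legOf_symm (σ : Fin n ≃ Fin n') (hσ : ∀ v, kH (σ v) = kG v) (hσ' : ∀ w, kG (σ.symm w) = kH w) (y : Leg kH) :
    legOf σ hσ (legOf σ.symm hσ' y) = y :=
  leg_ext (σ.apply_symm_apply y.1) (by simp [legOf])

/-- kernel: along an injective vertex map the leg map is injective. [cite: Balaban1983Higgs3, (1.17) p.415] -/
theorem legOf_injective {σ : Fin n → Fin n'} (hinj : Function.Injective σ) (hσ : ∀ v, kH (σ v) = kG v) :
    Function.Injective (legOf σ hσ) := by
  rintro ⟨v, s⟩ ⟨w, t⟩ h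
  have hvw : v = w := hinj (congrArg Sigma.fst h)
  subst hvw
  simp only [legOf, Sigma.mk.injEq, heq_eq_eq, true_and] at h
  rw [fibreCast_injective _ h]

end LegOf

/-! ## §2 Isomorphisms of graphs of the model -/

/-- **An ISOMORPHISM between two graphs of the model** («(ours)»; p. 415 takes graphs *"in the usual sense"*): a bijection of
the vertices keeping the catalogue kinds (1.6)–(1.15), whose induced bijection of the legs (`legOf`: same vertex image, same
slot) carries the line through every leg of `G` to the line through its image — internal lines to internal lines, external
legs to external legs. [cite: Balaban1983Higgs3, p.415] -/
structure GraphIso (G H : Graph nbar) where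
  /-- the bijection of the vertices -/
  toEquiv : Fin G.nV ≃ Fin H.nV
  /-- the catalogue kind of every vertex is kept -/
  kind_eq : ∀ v, H.kind (toEquiv v) = G.kind v
  /-- the induced leg map carries "the other endpoint of the line through a leg" of `G` to that of `H` -/
  map_other : ∀ x : Leg G.kind, H.other (legOf toEquiv kind_eq x) = (G.other x).map (legOf toEquiv kind_eq)

namespace GraphIso

variable {G H K : Graph nbar}

/-- The induced bijection of the legs (forward map). [cite: Balaban1983Higgs3, (1.17) p.415] -/
def legMap (e : GraphIso G H) : Leg G.kind → Leg H.kind :=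
  legOf e.toEquiv e.kind_eq

/-- kernel: the vertex of the image leg. [cite: Balaban1983Higgs3, (1.17) p.415] -/
@[simp] theorem fst_legMap (e : GraphIso G H) (x : Leg G.kind) : (e.legMap x).1 = e.toEquiv x.1 := rfl

/-- kernel: the species of the image leg. [cite: Balaban1983Higgs3, (1.17) p.415] -/
@[simp] theorem isLeft_legMap (e : GraphIso G H) (x : Leg G.kind) : (e.legMap x).2.isLeft = x.2.isLeft :=
  isLeft_legOf _ _ _

/-- kernel: the inverse vertex bijection keeps the kinds too. [cite: Balaban1983Higgs3, p.415] -/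
theorem kind_eq_symm (e : GraphIso G H) (w : Fin H.nV) : G.kind (e.toEquiv.symm w) = H.kind w :=
  (e.kind_eq _).symm.trans (congrArg H.kind (e.toEquiv.apply_symm_apply w))

/-- The induced bijection of the legs (backward map). [cite: Balaban1983Higgs3, (1.17) p.415] -/
def legInv (e : GraphIso G H) : Leg H.kind → Leg G.kind :=
  legOf e.toEquiv.symm e.kind_eq_symm

/-- kernel: the vertex of the preimage leg. [cite: Balaban1983Higgs3, (1.17) p.415] -/
@[simp] theorem fst_legInv (e : GraphIso G H) (y : Leg H.kind) : (e.legInv y).1 = e.toEquiv.symm y.1 := rfl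

/-- kernel: `legInv ∘ legMap = id`. [cite: Balaban1983Higgs3, (1.17) p.415] -/
@[simp] theorem legInv_legMap (e : GraphIso G H) (x : Leg G.kind) : e.legInv (e.legMap x) = x :=
  legOf_symm_legOf _ _ _ _

/-- kernel: `legMap ∘ legInv = id`. [cite: Balaban1983Higgs3, (1.17) p.415] -/
@[simp] theorem legMap_legInv (e : GraphIso G H) (y : Leg H.kind) : e.legMap (e.legInv y) = y :=
  legOf_legOf_symm _ _ _ _

/-- **the legs of isomorphic graphs correspond bijectively**. [cite: Balaban1983Higgs3, (1.17) p.415] -/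
def legEquiv (e : GraphIso G H) : Leg G.kind ≃ Leg H.kind where
  toFun := e.legMap
  invFun := e.legInv
  left_inv := e.legInv_legMap
  right_inv := e.legMap_legInv

/-- kernel: `legEquiv` is `legMap`. [cite: Balaban1983Higgs3, (1.17) p.415] -/
@[simp] theorem legEquiv_apply (e : GraphIso G H) (x : Leg G.kind) : e.legEquiv x = e.legMap x := rfl

/-- kernel: the leg map is injective. [cite: Balaban1983Higgs3, (1.17) p.415] -/
theorem legMap_injective (e : GraphIso G H) : Function.Injective e.legMap :=
  e.legEquiv.injective

/-- kernel: the leg map is surjective. [cite: Balaban1983Higgs3, (1.17) p.415] -/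
theorem legMap_surjective (e : GraphIso G H) : Function.Surjective e.legMap :=
  e.legEquiv.surjective

/-- **the lines are carried along**: `H.other (e x) = (G.other x).map e`. [cite: Balaban1983Higgs3, p.415] -/
theorem other_legMap (e : GraphIso G H) (x : Leg G.kind) : H.other (e.legMap x) = (G.other x).map e.legMap :=
  e.map_other x

/-- kernel: external legs go to external legs. [cite: Balaban1983Higgs3, p.415] -/
theorem other_legMap_eq_none_iff (e : GraphIso G H) {x : Leg G.kind} : H.other (e.legMap x) = none ↔ G.other x = none := by
  rw [e.other_legMap]
  simp

/-- kernel: the line `x — y` of `G` goes to the line `e x — e y` of `H`, and only lines arise so.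
[cite: Balaban1983Higgs3, p.415] -/
theorem other_legMap_eq_some_iff (e : GraphIso G H) {x y : Leg G.kind} :
    H.other (e.legMap x) = some (e.legMap y) ↔ G.other x = some y := by
  rw [e.other_legMap]
  cases G.other x with
  | none => simp
  | some z => simpa using e.legMap_injective.eq_iff

/-- kernel: internal legs go to internal legs. [cite: Balaban1983Higgs3, p.415] -/
@[simp] theorem isSome_other_legMap (e : GraphIso G H) (x : Leg G.kind) :
    (H.other (e.legMap x)).isSome = (G.other x).isSome := by
  rw [e.other_legMap, Option.isSome_map]

/-- **the identity isomorphism**. [cite: Balaban1983Higgs3, p.415] -/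
def refl (G : Graph nbar) : GraphIso G G where
  toEquiv := Equiv.refl _
  kind_eq _ := rfl
  map_other x := by
    have h : (legOf (Equiv.refl (Fin G.nV)) (fun _ => rfl) : Leg G.kind → Leg G.kind) = id :=
      funext fun y => leg_ext rfl (by simp [legOf])
    rw [h, Option.map_id]
    rfl

/-- **the inverse isomorphism**. [cite: Balaban1983Higgs3, p.415] -/
def symm (e : GraphIso G H) : GraphIso H G where
  toEquiv := e.toEquiv.symm
  kind_eq := e.kind_eq_symm
  map_other y := by
    have h := e.map_other (e.legInv y)
    change H.other (e.legMap (e.legInv y)) = (G.other (e.legInv y)).map e.legMap at h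
    rw [legMap_legInv] at h
    change G.other (e.legInv y) = (H.other y).map e.legInv
    rw [h, Option.map_map]
    have hc : (e.legInv ∘ e.legMap) = id := funext e.legInv_legMap
    rw [hc, Option.map_id, id]

/-- **composition of isomorphisms**. [cite: Balaban1983Higgs3, p.415] -/
def trans (e₁ : GraphIso G H) (e₂ : GraphIso H K) : GraphIso G K where
  toEquiv := e₁.toEquiv.trans e₂.toEquiv
  kind_eq v := (e₂.kind_eq (e₁.toEquiv v)).trans (e₁.kind_eq v)
  map_other x := by
    have hc : ∀ y : Leg G.kind, legOf (e₁.toEquiv.trans e₂.toEquiv)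
        (fun v => (e₂.kind_eq (e₁.toEquiv v)).trans (e₁.kind_eq v)) y = e₂.legMap (e₁.legMap y) := fun y => by
      unfold legMap
      rw [legOf_legOf]
      exact legOf_congr _ _ (fun _ => rfl) _
    rw [hc, e₂.other_legMap, e₁.other_legMap, Option.map_map]
    congr 1
    funext y
    exact (hc y).symm

/-- kernel: the vertex map of `refl`. [cite: Balaban1983Higgs3, p.415] -/
@[simp] theorem toEquiv_refl (G : Graph nbar) : (refl G).toEquiv = Equiv.refl _ := rfl

/-- kernel: the vertex map of `symm`. [cite: Balaban1983Higgs3, p.415] -/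
@[simp] theorem toEquiv_symm (e : GraphIso G H) : e.symm.toEquiv = e.toEquiv.symm := rfl

/-- kernel: the vertex map of `trans`. [cite: Balaban1983Higgs3, p.415] -/
@[simp] theorem toEquiv_trans (e₁ : GraphIso G H) (e₂ : GraphIso H K) :
    (e₁.trans e₂).toEquiv = e₁.toEquiv.trans e₂.toEquiv := rfl

/-- kernel: the leg map of `refl` is the identity. [cite: Balaban1983Higgs3, (1.17) p.415] -/
@[simp] theorem legMap_refl (x : Leg G.kind) : (refl G).legMap x = x :=
  leg_ext rfl (by simp [legMap, legOf])

/-- kernel: the leg map of `symm` is the backward leg map. [cite: Balaban1983Higgs3, (1.17) p.415] -/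
@[simp] theorem legMap_symm (e : GraphIso G H) : e.symm.legMap = e.legInv := rfl

/-- kernel: the leg map of `trans` is the composite. [cite: Balaban1983Higgs3, (1.17) p.415] -/
@[simp] theorem legMap_trans (e₁ : GraphIso G H) (e₂ : GraphIso H K) (x : Leg G.kind) :
    (e₁.trans e₂).legMap x = e₂.legMap (e₁.legMap x) := by
  unfold legMap
  rw [legOf_legOf]
  exact legOf_congr _ _ (fun _ => rfl) _

/-! ## §3 Transport along an isomorphism: adjacency, cuts, paths, connectedness, 1PI, properness, separating lines, levels -/

/-- kernel: an internal line of `G` gives an internal line of `H` between the image vertices. [cite: Balaban1983Higgs3, p.415] -/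
theorem adj_map (e : GraphIso G H) {v w : Fin G.nV} (h : Adj G v w) : Adj H (e.toEquiv v) (e.toEquiv w) := by
  obtain ⟨x, y, hxy, rfl, rfl⟩ := adj_iff.1 h
  exact adj_iff.2 ⟨e.legMap x, e.legMap y, e.other_legMap_eq_some_iff.2 hxy, rfl, rfl⟩

/-- **adjacency is transported**. [cite: Balaban1983Higgs3, p.415] -/
theorem adj_iff' (e : GraphIso G H) {v w : Fin G.nV} : Adj H (e.toEquiv v) (e.toEquiv w) ↔ Adj G v w :=
  ⟨fun h => by simpa using e.symm.adj_map h, e.adj_map⟩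

/-- kernel: an internal line of `G` other than the one through `c` gives one of `H` other than the one through `e c`.
[cite: Balaban1983Higgs3, (1.21) p.416] -/
theorem adjOff_map (e : GraphIso G H) {c : Leg G.kind} {v w : Fin G.nV} (h : AdjOff G c v w) :
    AdjOff H (e.legMap c) (e.toEquiv v) (e.toEquiv w) := by
  obtain ⟨x, y, hxy, hxc, hyc, rfl, rfl⟩ := adjOffOf_iff.1 h
  exact adjOffOf_iff.2 ⟨e.legMap x, e.legMap y, e.other_legMap_eq_some_iff.2 hxy,
    fun hx => hxc (e.legMap_injective hx), fun hy => hyc (e.legMap_injective hy), rfl, rfl⟩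

/-- **adjacency after a cut is transported**. [cite: Balaban1983Higgs3, (1.21) p.416] -/
theorem adjOff_iff' (e : GraphIso G H) {c : Leg G.kind} {v w : Fin G.nV} :
    AdjOff H (e.legMap c) (e.toEquiv v) (e.toEquiv w) ↔ AdjOff G c v w :=
  ⟨fun h => by simpa using e.symm.adjOff_map h, e.adjOff_map⟩

/-- kernel: a path of internal lines is transported. [cite: Balaban1983Higgs3, p.415] -/
theorem reflTransGen_adj_map (e : GraphIso G H) {v w : Fin G.nV} (h : ReflTransGen (Adj G) v w) :
    ReflTransGen (Adj H) (e.toEquiv v) (e.toEquiv w) := by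
  induction h with
  | refl => exact ReflTransGen.refl
  | tail _ hbc ih => exact ih.tail (e.adj_map hbc)

/-- **paths are transported**. [cite: Balaban1983Higgs3, p.415] -/
theorem reflTransGen_adj_iff (e : GraphIso G H) {v w : Fin G.nV} :
    ReflTransGen (Adj H) (e.toEquiv v) (e.toEquiv w) ↔ ReflTransGen (Adj G) v w :=
  ⟨fun h => by simpa using e.symm.reflTransGen_adj_map h, e.reflTransGen_adj_map⟩

/-- kernel: a path avoiding a cut is transported. [cite: Balaban1983Higgs3, (1.21) p.416] -/
theorem reflTransGen_adjOff_map (e : GraphIso G H) {c : Leg G.kind} {v w : Fin G.nV}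
    (h : ReflTransGen (AdjOff G c) v w) : ReflTransGen (AdjOff H (e.legMap c)) (e.toEquiv v) (e.toEquiv w) := by
  induction h with
  | refl => exact ReflTransGen.refl
  | tail _ hbc ih => exact ih.tail (e.adjOff_map hbc)

/-- **paths avoiding a cut are transported**. [cite: Balaban1983Higgs3, (1.21) p.416] -/
theorem reflTransGen_adjOff_iff (e : GraphIso G H) {c : Leg G.kind} {v w : Fin G.nV} :
    ReflTransGen (AdjOff H (e.legMap c)) (e.toEquiv v) (e.toEquiv w) ↔ ReflTransGen (AdjOff G c) v w :=
  ⟨fun h => by simpa using e.symm.reflTransGen_adjOff_map h, e.reflTransGen_adjOff_map⟩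

/-- **CONNECTEDNESS (p. 415 "connected in the usual sense") is invariant under isomorphism**. [cite: Balaban1983Higgs3, p.415] -/
theorem isConnected_iff (e : GraphIso G H) : IsConnected H ↔ IsConnected G := by
  constructor
  · intro h v w
    simpa using e.symm.reflTransGen_adj_map (h (e.toEquiv v) (e.toEquiv w))
  · intro h v w
    simpa using e.reflTransGen_adj_map (h (e.toEquiv.symm v) (e.toEquiv.symm w))

/-- kernel: connectedness after a cut is invariant. [cite: Balaban1983Higgs3, (1.21) p.416] -/
theorem isConnectedOff_iff (e : GraphIso G H) (c : Leg G.kind) : IsConnectedOff H (e.legMap c) ↔ IsConnectedOff G c := by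
  constructor
  · intro h v w
    simpa using e.symm.reflTransGen_adjOff_map (h (e.toEquiv v) (e.toEquiv w))
  · intro h v w
    simpa using e.reflTransGen_adjOff_map (h (e.toEquiv.symm v) (e.toEquiv.symm w))

/-- **ONE-PARTICLE-IRREDUCIBILITY (p. 416) is invariant under isomorphism**. [cite: Balaban1983Higgs3, (1.21) p.416] -/
theorem isOnePI_iff (e : GraphIso G H) : IsOnePI H ↔ IsOnePI G := by
  constructor
  · rintro ⟨hc, h⟩
    refine ⟨e.isConnected_iff.1 hc, fun c hcs => (e.isConnectedOff_iff c).1 (h _ (by simpa using hcs))⟩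
  · rintro ⟨hc, h⟩
    refine ⟨e.isConnected_iff.2 hc, fun c' hcs => ?_⟩
    obtain ⟨c, rfl⟩ := e.legMap_surjective c'
    exact (e.isConnectedOff_iff c).2 (h c (by simpa using hcs))

/-- **PROPERNESS (no line separates two external legs) is invariant under isomorphism**. [cite: Balaban1983Higgs3, (1.21) p.416] -/
theorem isProper_iff (e : GraphIso G H) : IsProper H ↔ IsProper G := by
  constructor
  · rintro ⟨hc, h⟩
    refine ⟨e.isConnected_iff.1 hc, fun c hcs x₁ x₂ h₁ h₂ => ?_⟩
    have := h (e.legMap c) (by simpa using hcs) (e.legMap x₁) (e.legMap x₂)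
      (e.other_legMap_eq_none_iff.2 h₁) (e.other_legMap_eq_none_iff.2 h₂)
    simpa using e.symm.reflTransGen_adjOff_map this
  · rintro ⟨hc, h⟩
    refine ⟨e.isConnected_iff.2 hc, fun c' hcs x₁' x₂' h₁ h₂ => ?_⟩
    obtain ⟨c, rfl⟩ := e.legMap_surjective c'
    obtain ⟨x₁, rfl⟩ := e.legMap_surjective x₁'
    obtain ⟨x₂, rfl⟩ := e.legMap_surjective x₂'
    exact e.reflTransGen_adjOff_map (h c (by simpa using hcs) x₁ x₂ (e.other_legMap_eq_none_iff.1 h₁)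
      (e.other_legMap_eq_none_iff.1 h₂))

/-- **a separating line goes to a separating line** (between the image roots). [cite: Balaban1983Higgs3, (1.21) p.416] -/
theorem sep_iff (e : GraphIso G H) {i j : Fin G.nV} {c : Leg G.kind} :
    Sep H (e.toEquiv i) (e.toEquiv j) (e.legMap c) ↔ Sep G i j c := by
  rw [B3OnePIChainDecomposition.Sep, B3OnePIChainDecomposition.Sep, isSome_other_legMap, reflTransGen_adjOff_iff]

/-- **a near leg goes to a near leg**. [cite: Balaban1983Higgs3, (1.21) p.416] -/
theorem isNear_iff (e : GraphIso G H) {i j : Fin G.nV} {c : Leg G.kind} :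
    IsNear H (e.toEquiv i) (e.toEquiv j) (e.legMap c) ↔ IsNear G i j c := by
  rw [IsNear, IsNear, sep_iff, fst_legMap, reflTransGen_adjOff_iff]

/-- kernel: the near legs of `H` between the image roots are the images of the near legs of `G`.
[cite: Balaban1983Higgs3, (1.21) p.416] -/
theorem nearLegs_eq (e : GraphIso G H) (i j : Fin G.nV) :
    nearLegs H (e.toEquiv i) (e.toEquiv j) = (nearLegs G i j).map e.legEquiv.toEmbedding := by
  ext c'
  obtain ⟨c, rfl⟩ := e.legMap_surjective c'
  rw [mem_nearLegs, isNear_iff, mem_map]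
  constructor
  · exact fun h => ⟨c, mem_nearLegs.2 h, rfl⟩
  · rintro ⟨d, hd, hdc⟩
    rw [← e.legMap_injective hdc]
    exact mem_nearLegs.1 hd

/-- **THE NUMBER OF SEPARATING LINES is invariant**: `numSep H (e i) (e j) = numSep G i j`. [cite: Balaban1983Higgs3, (1.21) p.416] -/
theorem numSep_eq (e : GraphIso G H) (i j : Fin G.nV) : numSep H (e.toEquiv i) (e.toEquiv j) = numSep G i j := by
  rw [numSep, numSep, nearLegs_eq, card_map]

/-- kernel: the lines a vertex lies beyond are carried along. [cite: Balaban1983Higgs3, (1.21) p.416] -/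
theorem beyond_eq (e : GraphIso G H) (i j v : Fin G.nV) :
    beyond H (e.toEquiv i) (e.toEquiv j) (e.toEquiv v) = (beyond G i j v).map e.legEquiv.toEmbedding := by
  ext c'
  obtain ⟨c, rfl⟩ := e.legMap_surjective c'
  rw [mem_beyond, isNear_iff, reflTransGen_adjOff_iff, mem_map]
  constructor
  · exact fun h => ⟨c, mem_beyond.2 h, rfl⟩
  · rintro ⟨d, hd, hdc⟩
    rw [← e.legMap_injective hdc]
    exact mem_beyond.1 hd

/-- **THE LEVEL FUNCTION is invariant**: `level H (e i) (e j) (e v) = level G i j v` — an isomorphism carries the pieces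
`V_k` of the chain decomposition of `G` onto those of `H`. [cite: Balaban1983Higgs3, (1.21) p.416] -/
theorem level_eq (e : GraphIso G H) (i j v : Fin G.nV) : level H (e.toEquiv i) (e.toEquiv j) (e.toEquiv v) = level G i j v := by
  rw [level, level, beyond_eq, card_map]

/-- **THE NUMBER OF EXTERNAL LEGS is invariant** (p18's count `Graph.numExtLegs`). [cite: Balaban1983Higgs3, (2.17) p.429] -/
theorem numExtLegs_eq (e : GraphIso G H) : H.numExtLegs = G.numExtLegs := by
  rw [Graph.numExtLegs_eq_card, Graph.numExtLegs_eq_card]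
  have hEq : (univ.filter fun y : Leg H.kind => H.other y = none) =
      (univ.filter fun x : Leg G.kind => G.other x = none).map e.legEquiv.toEmbedding := by
    ext y
    obtain ⟨x, rfl⟩ := e.legMap_surjective y
    simp only [mem_filter, mem_univ, true_and, mem_map, Equiv.coe_toEmbedding, legEquiv_apply]
    rw [other_legMap_eq_none_iff]
    constructor
    · exact fun h => ⟨x, h, rfl⟩
    · rintro ⟨x', hx', h⟩
      rwa [← e.legMap_injective h]
  rw [hEq, card_map]

end GraphIso

/-! ## §4 Isomorphisms of two-leg insertions -/

/-- **An ISOMORPHISM between two two-leg insertions** (p37's `B3OnePIChainGlue.TwoLegGraph`; «(ours)»): an isomorphism of the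
underlying graphs carrying the in-leg to the in-leg and the out-leg to the out-leg. [cite: Balaban1983Higgs3, (1.21) p.416] -/
structure TwoLegGraphIso (T T' : TwoLegGraph nbar) extends GraphIso T.G T'.G where
  /-- the in-leg goes to the in-leg -/
  map_legIn : legOf toEquiv kind_eq T.legIn = T'.legIn
  /-- the out-leg goes to the out-leg -/
  map_legOut : legOf toEquiv kind_eq T.legOut = T'.legOut

namespace TwoLegGraphIso

variable {T T' T'' : TwoLegGraph nbar}

/-- kernel: the in-leg goes to the in-leg. [cite: Balaban1983Higgs3, (1.21) p.416] -/
@[simp] theorem legMap_legIn (e : TwoLegGraphIso T T') : e.toGraphIso.legMap T.legIn = T'.legIn := e.map_legIn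

/-- kernel: the out-leg goes to the out-leg. [cite: Balaban1983Higgs3, (1.21) p.416] -/
@[simp] theorem legMap_legOut (e : TwoLegGraphIso T T') : e.toGraphIso.legMap T.legOut = T'.legOut := e.map_legOut

/-- kernel: the vertex of the in-leg goes to the vertex of the in-leg. [cite: Balaban1983Higgs3, (1.21) p.416] -/
@[simp] theorem toEquiv_legIn_fst (e : TwoLegGraphIso T T') : e.toEquiv T.legIn.1 = T'.legIn.1 := by
  rw [← e.legMap_legIn]; rfl

/-- kernel: the vertex of the out-leg goes to the vertex of the out-leg. [cite: Balaban1983Higgs3, (1.21) p.416] -/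
@[simp] theorem toEquiv_legOut_fst (e : TwoLegGraphIso T T') : e.toEquiv T.legOut.1 = T'.legOut.1 := by
  rw [← e.legMap_legOut]; rfl

/-- **the identity**. [cite: Balaban1983Higgs3, (1.21) p.416] -/
def refl (T : TwoLegGraph nbar) : TwoLegGraphIso T T where
  toGraphIso := GraphIso.refl T.G
  map_legIn := GraphIso.legMap_refl T.legIn
  map_legOut := GraphIso.legMap_refl T.legOut

/-- **the inverse**. [cite: Balaban1983Higgs3, (1.21) p.416] -/
def symm (e : TwoLegGraphIso T T') : TwoLegGraphIso T' T where
  toGraphIso := e.toGraphIso.symm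
  map_legIn := by
    change e.toGraphIso.symm.legMap T'.legIn = T.legIn
    rw [GraphIso.legMap_symm, ← e.legMap_legIn, GraphIso.legInv_legMap]
  map_legOut := by
    change e.toGraphIso.symm.legMap T'.legOut = T.legOut
    rw [GraphIso.legMap_symm, ← e.legMap_legOut, GraphIso.legInv_legMap]

/-- **the composite**. [cite: Balaban1983Higgs3, (1.21) p.416] -/
def trans (e₁ : TwoLegGraphIso T T') (e₂ : TwoLegGraphIso T' T'') : TwoLegGraphIso T T'' where
  toGraphIso := e₁.toGraphIso.trans e₂.toGraphIso
  map_legIn := by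
    change (e₁.toGraphIso.trans e₂.toGraphIso).legMap T.legIn = T''.legIn
    rw [GraphIso.legMap_trans, legMap_legIn, legMap_legIn]
  map_legOut := by
    change (e₁.toGraphIso.trans e₂.toGraphIso).legMap T.legOut = T''.legOut
    rw [GraphIso.legMap_trans, legMap_legOut, legMap_legOut]

/-- **isomorphic insertions have the same number of separating lines between their ports** (the same number of pieces).
[cite: Balaban1983Higgs3, (1.21) p.416] -/
theorem numSep_eq (e : TwoLegGraphIso T T') :
    numSep T'.G T'.legIn.1 T'.legOut.1 = numSep T.G T.legIn.1 T.legOut.1 := by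
  rw [← toEquiv_legIn_fst, ← toEquiv_legOut_fst, e.toGraphIso.numSep_eq]

/-- **… and corresponding vertices have the same level** (the pieces correspond). [cite: Balaban1983Higgs3, (1.21) p.416] -/
theorem level_eq (e : TwoLegGraphIso T T') (v : Fin T.G.nV) :
    level T'.G T'.legIn.1 T'.legOut.1 (e.toEquiv v) = level T.G T.legIn.1 T.legOut.1 v := by
  rw [← toEquiv_legIn_fst, ← toEquiv_legOut_fst, e.toGraphIso.level_eq]

/-- kernel: isomorphic insertions are connected together. [cite: Balaban1983Higgs3, p.415] -/
theorem isConnected_iff (e : TwoLegGraphIso T T') : IsConnected T'.G ↔ IsConnected T.G :=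
  e.toGraphIso.isConnected_iff

/-- kernel: … proper together. [cite: Balaban1983Higgs3, (1.21) p.416] -/
theorem isProper_iff (e : TwoLegGraphIso T T') : IsProper T'.G ↔ IsProper T.G :=
  e.toGraphIso.isProper_iff

/-- kernel: … 1PI together. [cite: Balaban1983Higgs3, (1.21) p.416] -/
theorem isOnePI_iff (e : TwoLegGraphIso T T') : IsOnePI T'.G ↔ IsOnePI T.G :=
  e.toGraphIso.isOnePI_iff

/-- kernel: … and have the same number of external legs. [cite: Balaban1983Higgs3, (1.21) p.416] -/
theorem numExtLegs_eq (e : TwoLegGraphIso T T') : T'.G.numExtLegs = T.G.numExtLegs :=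
  e.toGraphIso.numExtLegs_eq

end TwoLegGraphIso

end Literature.MathematicalPhysics.QuantumFieldTheory.Balaban1983to89.B3GraphIso
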